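import Summits.ResolutionOfSingularities.ResolutionOfSingularities.Theorems.PurelyInseparableDim4ResConeTwoSlotGameFree
import HarnessLib
import HarnessLib.Audit.Tags

/-!
# Purely inseparable four-folds — TWO-SLOT GAME, AMENDED FLAG for rotation steps: «… or `x_λ ∈ S₁`», which is
# `λ`-illegal and `μ`-fixed (cell `res-dim4-pi`, K2(p) lane, slice B brick K24a, R1′ part γ₀″)

[OURS · counted 0 · cell `res-dim4-pi` · K2(p) lane (holder res-dim4-p-12 g3; K24a-R1′(β) shadow audit, bus 2026-08-29
04:39Z); the game = res-dim4-idea-4 g3; seat res-dim4-p-1 g4 over `…TwoSlotGameFree` (γ₀′).]  Nothing here proves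
K2(p)/K2(5), `NoIsolatedTrap p p` or resolution of singularities in dimension ≥ 4 / characteristic `p`.  AI kernel work, weaker
than expert review.

WHY.  Through a ROTATION step the readings of the child's canonical frame are obtained from those of the swap partner by a
unit-class transfer (res-dim4-p-7 g4's `SwapNorm.coeff_of_unitClass_rel`, order `s = 3`); every game reading transfers cleanly
except the degree-6 flag member `x_λx_μ³ ∈ S₀` (residual `x_λ²x_μ⁴`), whose live shadows are `x_λ ∈ S₁` (`t 1 0 0`) and
`x_μ ∈ S₁` (`t 0 1 0`, already in the flag).  So the flag after a `λ`-step is AMENDED to «… or `t (m+1) 1 0 0 ≠ 0`», with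
the two instance facts the per-step package already supplies: `λ`-LEGALITY `t m 1 0 0 = 0` (β5's fifth vanishing,
`S₁ ∌ x_λ`) and `μ`-PERSISTENCE `t m 1 0 0 ≠ 0 → t (m+1) 1 0 0 ≠ 0` (chart law: `x_f x_λ²x_μ` is `μ`-fixed).

* §1 **`twoSlot_freeze_or_flip`** — after `λ` at `k`, `μ` at `k + 1`: EITHER every step from `k + 2` on is `λ` (with
  `x_λx_μ² ∈ S₀`), OR `x_λ ∈ S₁` from `k + 1` on and every step from `k + 1` on is `μ`.
* §2 **`twoSlot_eventually_constant''`** — hence one slot moves for ever; **`no_twoSlot_tail_of_readings_amended`** — with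
  γ₀′'s slot bookkeeping (`no_free_slot_tail`) such a tail is free: `False`.

[cite: CossartJannsenSaito2020, Thm. 3.14, Thm. 9.3] bears_on: LADDER-RESOLUTION:D157-DOOR2 (res-dim4-pi · K2(p) · slice B ·
K24a-R1′ γ₀″).  Supports stmt-ResolutionOfSingularities-16155 (helper).
-/

set_option linter.dupNamespace false -- mandated namespace of this single-conjunct summit

namespace Summit.ResolutionOfSingularities.ResolutionOfSingularities.Theorems.PIDim4

namespace ResCone

open Literature.AlgebraicGeometry.Resolution
open Literature.AlgebraicGeometry.Resolution.CentreBlowup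

variable {K : Type} [Field K]

/-! ## 1. Freeze or flip -/

/-- **FREEZE OR FLIP** (amended two-slot game): readings `s t`, `L m` = «step `m` moves slot `λ`»; relabelings as
implications, `λ`-legality `x_λx_μ ∉ S₀ ∧ x_λ ∉ S₁`, `μ`-legality as before, `μ`-persistence of `x_λ ∈ S₁`, and the AMENDED
flag «six or `x_λ ∈ S₁`».  After `λ` at `k` and `μ` at `k + 1`: either `∀ m ≥ k + 2, L m ∧ s m 1 2 0 ≠ 0`, or
`∀ m ≥ k + 1, ¬ L m ∧ t m 1 0 0 ≠ 0`. [OURS · idea-4's argument + the rotation amendment] [folklore] -/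
theorem twoSlot_freeze_or_flip {s t : ℕ → ℕ → ℕ → ℕ → K} {L : ℕ → Prop}
    (hfix : ∀ m, L m → s m 1 2 0 ≠ 0 → s (m + 1) 1 2 0 ≠ 0)
    (hmuA : ∀ m, ¬ L m → s m 1 2 0 ≠ 0 → s (m + 1) 1 1 0 ≠ 0)
    (hmuB : ∀ m, ¬ L m → s m 1 3 0 ≠ 0 → s (m + 1) 1 2 0 ≠ 0)
    (hmuT : ∀ m, ¬ L m → t m 1 0 0 ≠ 0 → t (m + 1) 1 0 0 ≠ 0)
    (hlegL : ∀ m, L m → s m 1 1 0 = 0 ∧ t m 1 0 0 = 0)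
    (hlegM : ∀ m, ¬ L m → s m 0 2 0 = 0 ∧ s m 1 1 0 = 0 ∧ s m 0 1 1 = 0 ∧ t m 0 1 0 = 0)
    (hflag : ∀ m, L m → s (m + 1) 0 2 0 ≠ 0 ∨ s (m + 1) 1 1 0 ≠ 0 ∨ s (m + 1) 0 1 1 ≠ 0 ∨
      s (m + 1) 1 2 0 ≠ 0 ∨ s (m + 1) 1 3 0 ≠ 0 ∨ t (m + 1) 0 1 0 ≠ 0 ∨ t (m + 1) 1 0 0 ≠ 0)
    {k : ℕ} (hk : L k) (hk1 : ¬ L (k + 1)) :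
    (∀ m, k + 2 ≤ m → L m ∧ s m 1 2 0 ≠ 0) ∨ (∀ m, k + 1 ≤ m → ¬ L m ∧ t m 1 0 0 ≠ 0) := by
  -- `x_λ x_μ ∈ S₀` is illegal for both letters
  have hkill : ∀ m, s m 1 1 0 ≠ 0 → False := fun m h => by
    by_cases hL : L m
    · exact h (hlegL m hL).1
    · exact h (hlegM m hL).2.1
  -- a `μ`-step on `x_λ x_μ² ∈ S₀` is fatal one step later
  have hstay : ∀ m, s m 1 2 0 ≠ 0 → L m := fun m h => by
    by_contra hL
    exact hkill (m + 1) (hmuA m hL h)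
  -- `x_λ ∈ S₁` forbids `λ` and persists under `μ`
  have hflip : ∀ m₀, t m₀ 1 0 0 ≠ 0 → ∀ m, m₀ ≤ m → ¬ L m ∧ t m 1 0 0 ≠ 0 := by
    intro m₀ h0 m hm
    induction m, hm using Nat.le_induction with
    | base => exact ⟨fun hL => h0 (hlegL m₀ hL).2, h0⟩
    | succ m _ ih =>
      have h' : t (m + 1) 1 0 0 ≠ 0 := hmuT m ih.1 ih.2
      exact ⟨fun hL => h' (hlegL (m + 1) hL).2, h'⟩
  -- the flag at `k + 1`
  obtain ⟨h020, h110, h011, h010⟩ := hlegM (k + 1) hk1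
  rcases hflag k hk with h | h | h | h | h | h | h
  · exact absurd h020 h
  · exact absurd h110 h
  · exact absurd h011 h
  · exact (hkill (k + 2) (hmuA (k + 1) hk1 h)).elim
  · -- `x_λ x_μ³ ∈ S₀` at `k + 1`: the freeze
    left
    have h120 : s (k + 2) 1 2 0 ≠ 0 := hmuB (k + 1) hk1 h
    intro m hm
    induction m, hm using Nat.le_induction with
    | base => exact ⟨hstay _ h120, h120⟩
    | succ m _ ih =>
      have h' : s (m + 1) 1 2 0 ≠ 0 := hfix m ih.1 ih.2
      exact ⟨hstay _ h', h'⟩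
  · exact absurd h010 h
  · -- `x_λ ∈ S₁` at `k + 1`: the flip
    exact Or.inr (hflip (k + 1) h)

/-! ## 2. One slot moves for ever; the tail is free -/

/-- **THE SLOT IS EVENTUALLY CONSTANT** (amended game). [OURS · idea-4's argument + the rotation amendment] [folklore] -/
theorem twoSlot_eventually_constant'' {s t : ℕ → ℕ → ℕ → ℕ → K} {L : ℕ → Prop}
    (hfix : ∀ m, L m → s m 1 2 0 ≠ 0 → s (m + 1) 1 2 0 ≠ 0)
    (hmuA : ∀ m, ¬ L m → s m 1 2 0 ≠ 0 → s (m + 1) 1 1 0 ≠ 0)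
    (hmuB : ∀ m, ¬ L m → s m 1 3 0 ≠ 0 → s (m + 1) 1 2 0 ≠ 0)
    (hmuT : ∀ m, ¬ L m → t m 1 0 0 ≠ 0 → t (m + 1) 1 0 0 ≠ 0)
    (hlegL : ∀ m, L m → s m 1 1 0 = 0 ∧ t m 1 0 0 = 0)
    (hlegM : ∀ m, ¬ L m → s m 0 2 0 = 0 ∧ s m 1 1 0 = 0 ∧ s m 0 1 1 = 0 ∧ t m 0 1 0 = 0)
    (hflag : ∀ m, L m → s (m + 1) 0 2 0 ≠ 0 ∨ s (m + 1) 1 1 0 ≠ 0 ∨ s (m + 1) 0 1 1 ≠ 0 ∨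
      s (m + 1) 1 2 0 ≠ 0 ∨ s (m + 1) 1 3 0 ≠ 0 ∨ t (m + 1) 0 1 0 ≠ 0 ∨ t (m + 1) 1 0 0 ≠ 0) :
    ∃ N, (∀ m, N ≤ m → L m) ∨ (∀ m, N ≤ m → ¬ L m) := by
  by_cases hchange : ∃ k, L k ∧ ¬ L (k + 1)
  · obtain ⟨k, hk, hk1⟩ := hchange
    rcases twoSlot_freeze_or_flip hfix hmuA hmuB hmuT hlegL hlegM hflag hk hk1 with h | h
    · exact ⟨k + 2, Or.inl fun m hm => (h m hm).1⟩
    · exact ⟨k + 1, Or.inr fun m hm => (h m hm).1⟩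
  · push Not at hchange
    by_cases hsome : ∃ k, L k
    · obtain ⟨k, hk⟩ := hsome
      refine ⟨k, Or.inl fun m hm => ?_⟩
      induction m, hm using Nat.le_induction with
      | base => exact hk
      | succ m _ ih => exact hchange m ih
    · push Not at hsome
      exact ⟨0, Or.inr fun m _ => hsome m⟩

section Free

variable (p : ℕ) [Fact p.Prime] [CharP K p] [DecidableEq K]

/-- **THE TWO-SLOT TAIL WITH ROTATING LETTERS, MODULO ITS AMENDED READINGS** (K24a-R1′ γ₀″): γ₀′
(`no_twoSlot_tail_of_readings_free`) with the amended flag and the two extra instance hypotheses. [OURS]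
[cite: CossartJannsenSaito2020, Thm. 3.14, Thm. 9.3] -/
theorem no_twoSlot_tail_of_readings_amended {c : ℕ → State K} {j : ℕ → Fin 4} {b : ℕ → Fin 4 → K}
    (hc : ∀ k, IsIsolated p (c k).F) (hw : FreeTail.IsWitnessedChain p c j b) {k₁ : ℕ} {A B : ℕ → Fin 4}
    {L : ℕ → Prop} (hA : ∀ m, L m → A (m + 1) = j (k₁ + m))
    (hstepA : ∀ m, L m → j (k₁ + m) = A m ∨ b (k₁ + m) (A m) ≠ 0)
    (hB : ∀ m, ¬ L m → B (m + 1) = j (k₁ + m))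
    (hstepB : ∀ m, ¬ L m → j (k₁ + m) = B m ∨ b (k₁ + m) (B m) ≠ 0) {s t : ℕ → ℕ → ℕ → ℕ → K}
    (hfix : ∀ m, L m → s m 1 2 0 ≠ 0 → s (m + 1) 1 2 0 ≠ 0)
    (hmuA : ∀ m, ¬ L m → s m 1 2 0 ≠ 0 → s (m + 1) 1 1 0 ≠ 0)
    (hmuB : ∀ m, ¬ L m → s m 1 3 0 ≠ 0 → s (m + 1) 1 2 0 ≠ 0)
    (hmuT : ∀ m, ¬ L m → t m 1 0 0 ≠ 0 → t (m + 1) 1 0 0 ≠ 0)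
    (hlegL : ∀ m, L m → s m 1 1 0 = 0 ∧ t m 1 0 0 = 0)
    (hlegM : ∀ m, ¬ L m → s m 0 2 0 = 0 ∧ s m 1 1 0 = 0 ∧ s m 0 1 1 = 0 ∧ t m 0 1 0 = 0)
    (hflag : ∀ m, L m → s (m + 1) 0 2 0 ≠ 0 ∨ s (m + 1) 1 1 0 ≠ 0 ∨ s (m + 1) 0 1 1 ≠ 0 ∨
      s (m + 1) 1 2 0 ≠ 0 ∨ s (m + 1) 1 3 0 ≠ 0 ∨ t (m + 1) 0 1 0 ≠ 0 ∨ t (m + 1) 1 0 0 ≠ 0) : False := by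
  obtain ⟨N, hN⟩ := twoSlot_eventually_constant'' hfix hmuA hmuB hmuT hlegL hlegM hflag
  rcases hN with hL | hM
  · exact no_free_slot_tail p hc hw hA hstepA hL
  · exact no_free_slot_tail p hc hw (L := fun m => ¬ L m) hB hstepB hM

end Free

end ResCone

end Summit.ResolutionOfSingularities.ResolutionOfSingularities.Theorems.PIDim4
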